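import Mathlib
import Literature.Analysis.ValidatedNumerics.TaylorModelIntegralCertTrig
import Literature.Analysis.ValidatedNumerics.TaylorModelExpr
import Summits.Ventures.FusionMHD.Models.CerfonFreidbergNstxLikeAxisCert
import HarnessLib

/-!
# Ventures/FusionMHD — Models/CerfonFreidbergNstxLikeShapeCert.lean: the flux of record `U` of THE Cerfon–Freidberg
# NSTX-like instance along Freidberg's printed reference surface (6.154), as a straight-line program of the tree's
# Taylor-model lane, and the KERNEL RANGE CERTIFICATE `−28/10⁵ ≤ U ≤ 8/10⁵` on `τ ∈ [0, 3217/1024] ⊃ [0, π]`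

HONEST FRAMING (LADDER-GRIDFUSION three columns; CF rung; MODEL-VALIDITY companion of S2 #47 «F1.CF-AXIS-NSTX»; NSTX-like TWIN of `Models/CerfonFreidbergIterLikeShapeCert.lean`).  The
Cerfon–Freidberg construction fits the seven point / slope / curvature conditions (6.155) on the printed D-shaped
reference surface `X = 1 + ε cos(τ + δ₀ sin τ)`, `Y = εκ sin τ` (Freidberg 2014 (6.154); `(ε, κ, δ) = (39/50, 2,
7/20)`, `δ₀ = arcsin δ`) — it does NOT impose `U = 0` along that curve.  This file is the MACHINE part of the
certificate that measures the mismatch; the user-facing theorems (all real `τ`, `|ψ_N − 1| ≤ 1/40000`, the vertical gap to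
the model separatrix) are in `Models/CerfonFreidbergNstxLikeShapeFidelity.lean`.

* §1 `refProg : TProg` — `U(c; X(τ), Y(τ))` as a 77-statement straight-line program (Melquiond 2008 §3.3 stack programs of
  `Literature/Analysis/ValidatedNumerics/TaylorModelIntegralCertTrig.lean`: `sin` / `cos` / `log` statements, rational
  `poly` constants, `add` / `mul` / `neg`; parameters `c₀…c₆, t` on the initial stack) and the identification
  `refProg_toFunP : refProg(c, t; τ) = cfSolution 0 c (1 + ε cos(τ + t sin τ)) (εκ sin τ)`, `ε = 39/50`, `κ = 2` (symbolic run, `simp` + `ring`);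
* §2 the parameter box `refBox` = coordinates 0–7 of #47's Krawczyk box `CFNstxLike.axKrawczyk.box` (width 2⁻²⁹) and
  `boxMem_params : BoxMem [coeff 0, …, coeff 6, δ₀] refBox` (from `axZero_mem`, `axZero_seven`); `refU τ` := `U` of THE
  instance on the reference curve, `refU_eq_toFunP`;
* §3 the certificate: sixteen panels of half-width `h = 3217/32768` centred at `(2j+1)h`; on each the program's Taylor model
  (scaled-integer arithmetic `S = 2⁶⁰`, degree 6, composition order 14; `TProg.pmodelP`, soundness `TProg.tmem_pmodelP`,
  range read-out `tlowerI` / `tupperI` / `bounds_of_tmem`) is accepted with range inside `[−28, 8]·10⁻⁵` — FOUR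
  `decide +kernel` of four panels each (`panels_ok₁…₄`, ≈ 15–30 s each on the farm), two zero-width panels for the point facts
  `U(201/256) ≤ −23/10⁵`, `U(151/64) ≥ 6/10⁵` (`pointIn_ok`, `pointOut_ok`); the covering lemma `exists_panel` and
  **`refProg_bounds_Icc`**: `−28/10⁵ ≤ refProg(params; τ) ≤ 8/10⁵` for `0 ≤ τ ≤ 3217/1024`.

No `native_decide`; axioms standard.  VALIDATED (never used in a proof): gridfusion's Arb lineage
bench/F2-CF-NSTX-alpha0-lineage1.json 0dec53189869c976 (`reference_surface_check`: max |U| = 2.39·10⁻⁴ over 64 samples; a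
float scan gives −2.39·10⁻⁴ at τ ≈ 0.80 and +7.10·10⁻⁵ at τ ≈ 2.24) — inside the kernel range; ≈ 330× the ITER-like mismatch.  MODELLED: analytic
Cerfon–Freidberg family (ideal MHD, Solov'ev profiles `A = 0`, fixed analytic boundary); nothing here is a stability statement.
Generator of the program text: HOME models/gen-model-5/proggen.py (pure python; float replay of the stack machine against the
closed form to 1e-17).  Typer/prover: gridfusion-model-5 (g6), 2026-08-27.
Citations: Freidberg 2014 §6.6.1 (6.153)–(6.156) [Freidberg2014]; Pataki–Cerfon–Freidberg 2013 §6.1 [PatakiCerfonFreidberg2013];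
Melquiond 2008 §3.3 [Melquiond2008]; Joldes 2011 Alg. 2.2.10 [Joldes2011]; Makino–Berz 2003 [MakinoBerz2003].
-/

noncomputable section

open Set
open Literature.Analysis.ValidatedNumerics Literature.Analysis.ValidatedNumerics.PolyMP
open Literature.Analysis.ValidatedNumerics.NumericsMP Literature.Analysis.ValidatedNumerics.ExpPoly
open Literature.Analysis.ODE
open Literature.MathematicalPhysics.MHD Literature.MathematicalPhysics.MHD.CerfonFreidberg _root_.Real

namespace Summit.Ventures.FusionMHD.Models.CFNstxLike

set_option maxRecDepth 100000

/-! ## §1 The flux along the reference curve as a straight-line program, and its identification -/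

/-- **The program.**  Parameters on the initial stack (top first) `c₀, c₁, …, c₆, t`; variable `τ`; 77 statements
computing, with shared registers, `sin τ`, `θ = τ + t sin τ`, `cos θ`, `X = 1 + (39/50) cos θ`, `Y = (39/25) sin τ`,
`log X`, `X²`, `Y²` and then `U = P₀(X², Y²) + log X · P₁(X², Y²)` in Horner form, `P₀`, `P₁` the polynomial and
logarithmic parts of the `α = 0` Cerfon–Freidberg family (6.153) (generator HOME models/gen-model-5/proggen_shape.py, NSTX constants;
addresses are stack-relative as in Melquiond 2008 §3.3).  MODELLED: analytic CF family. -/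
def refProg : TProg :=
  [TOp.base (SOp.poly [0, 1]),
  TOp.sin 0,
  TOp.base (SOp.mul 9 0),
  TOp.base (SOp.add 2 0),
  TOp.cos 0,
  TOp.base (SOp.poly [(39 / 50)]),
  TOp.base (SOp.mul 0 1),
  TOp.base (SOp.poly [1]),
  TOp.base (SOp.add 0 1),
  TOp.base (SOp.poly [(39 / 25)]),
  TOp.base (SOp.mul 0 8),
  TOp.base (SOp.log 2),
  TOp.base (SOp.mul 3 3),
  TOp.base (SOp.mul 2 2),
  TOp.base (SOp.poly [8]),
  TOp.base (SOp.mul 0 21),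
  TOp.base (SOp.mul 0 2),
  TOp.base (SOp.poly [2]),
  TOp.base (SOp.mul 0 22),
  TOp.base (SOp.add 0 2),
  TOp.base (SOp.mul 0 6),
  TOp.base (SOp.add 23 0),
  TOp.base (SOp.mul 0 8),
  TOp.base (SOp.add 23 0),
  TOp.base (SOp.poly [(-4)]),
  TOp.base (SOp.mul 0 28),
  TOp.base (SOp.poly [(-9)]),
  TOp.base (SOp.mul 0 31),
  TOp.base (SOp.add 2 0),
  TOp.base (SOp.poly [8]),
  TOp.base (SOp.mul 0 35),
  TOp.base (SOp.poly [(-140)]),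
  TOp.base (SOp.mul 0 38),
  TOp.base (SOp.add 2 0),
  TOp.base (SOp.mul 0 20),
  TOp.base (SOp.add 6 0),
  TOp.base (SOp.mul 0 22),
  TOp.base (SOp.add 38 0),
  TOp.base (SOp.poly [(1 / 8)]),
  TOp.base (SOp.add 0 42),
  TOp.base (SOp.poly [(-12)]),
  TOp.base (SOp.mul 0 46),
  TOp.base (SOp.poly [75]),
  TOp.base (SOp.mul 0 49),
  TOp.base (SOp.add 2 0),
  TOp.base (SOp.mul 0 31),
  TOp.base (SOp.add 6 0),
  TOp.base (SOp.mul 34 52),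
  TOp.base (SOp.add 1 0),
  TOp.base (SOp.mul 36 0),
  TOp.base (SOp.add 12 0),
  TOp.base (SOp.mul 38 0),
  TOp.base (SOp.add 28 0),
  TOp.base (SOp.neg 55),
  TOp.base (SOp.poly [(-12)]),
  TOp.base (SOp.mul 0 59),
  TOp.base (SOp.poly [(-120)]),
  TOp.base (SOp.mul 0 63),
  TOp.base (SOp.mul 0 44),
  TOp.base (SOp.add 3 0),
  TOp.base (SOp.mul 0 46),
  TOp.base (SOp.add 7 0),
  TOp.base (SOp.poly [3]),
  TOp.base (SOp.mul 0 67),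
  TOp.base (SOp.poly [180]),
  TOp.base (SOp.mul 0 71),
  TOp.base (SOp.mul 0 52),
  TOp.base (SOp.add 3 0),
  TOp.base (SOp.poly [(-15)]),
  TOp.base (SOp.mul 0 75),
  TOp.base (SOp.mul 57 0),
  TOp.base (SOp.add 3 0),
  TOp.base (SOp.mul 59 0),
  TOp.base (SOp.add 11 0),
  TOp.base (SOp.mul 61 0),
  TOp.base (SOp.mul 63 0),
  TOp.base (SOp.add 23 0)]

/-- **Identification:** the program denotes `τ ↦ U(c; 1 + ε cos(τ + t sin τ), εκ sin τ)` for every parameter vector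
(symbolic execution of the 77 statements, then `ring`). -/
theorem refProg_toFunP (c0 c1 c2 c3 c4 c5 c6 t τ : ℝ) :
    refProg.toFunP [c0, c1, c2, c3, c4, c5, c6, t] τ
      = cfSolution 0 ![c0, c1, c2, c3, c4, c5, c6] (1 + ε * Real.cos (τ + t * Real.sin τ)) (ε * κ * Real.sin τ) := by
  simp [refProg, TProg.toFunP, TProg.runF, TOp.evalF, SOp.evalF, getReg, constStack, Poly.eval, cfSolution,
    UP, U0, U1, U2, U3, U4, U5, U6, ε, κ]
  ring

/-! ## §2 The parameter box of THE instance (coordinates 0–7 of #34's Krawczyk box) -/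

/-- The parameter box: the `c`-coordinates 0–6 and the `t = δ₀` coordinate 7 of `CFNstxLike.axKrawczyk.box` (centre ± 2⁻³⁰). -/
def refBox : PBox :=
  [((axKrawczyk.box 0).fst, (axKrawczyk.box 0).snd), ((axKrawczyk.box 1).fst, (axKrawczyk.box 1).snd),
   ((axKrawczyk.box 2).fst, (axKrawczyk.box 2).snd), ((axKrawczyk.box 3).fst, (axKrawczyk.box 3).snd),
   ((axKrawczyk.box 4).fst, (axKrawczyk.box 4).snd), ((axKrawczyk.box 5).fst, (axKrawczyk.box 5).snd),
   ((axKrawczyk.box 6).fst, (axKrawczyk.box 6).snd), ((axKrawczyk.box 7).fst, (axKrawczyk.box 7).snd)]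

/-- The parameters of THE NSTX-like instance of record: `coeff 0 … coeff 6` and `δ₀ = arcsin (7/20)`. -/
def params : List ℝ := [coeff 0, coeff 1, coeff 2, coeff 3, coeff 4, coeff 5, coeff 6, δ₀]

/-- Coordinate bounds of the certified zero `CFNstxLike.axZero` of #47 (from `CFNstxLike.axZero_mem`). -/
theorem axZeroN_coord (k : Fin 18) :
    ((CFNstxLike.axKrawczyk.box k).fst : ℝ) ≤ CFNstxLike.axZero k ∧
      CFNstxLike.axZero k ≤ ((CFNstxLike.axKrawczyk.box k).snd : ℝ) := by
  have h := mem_boxSet_iff.mp CFNstxLike.axZero_mem k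
  rw [castBox_apply, NonemptyInterval.mem_ratCast_iff] at h
  exact h

/-- The NSTX-like coefficient vector written out is `CFNstxLike.coeff`. -/
theorem coeffN_vec : (![CFNstxLike.coeff 0, CFNstxLike.coeff 1, CFNstxLike.coeff 2, CFNstxLike.coeff 3, CFNstxLike.coeff 4,
    CFNstxLike.coeff 5, CFNstxLike.coeff 6] : Fin 7 → ℝ) = CFNstxLike.coeff := by
  funext j; fin_cases j <;> simp

/-- `CFNstxLike.coeff j` is coordinate `j` of `CFNstxLike.axZero`. -/
theorem coeffN_eq_axZero : CFNstxLike.coeff 0 = CFNstxLike.axZero 0 ∧ CFNstxLike.coeff 1 = CFNstxLike.axZero 1 ∧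
    CFNstxLike.coeff 2 = CFNstxLike.axZero 2 ∧ CFNstxLike.coeff 3 = CFNstxLike.axZero 3 ∧
    CFNstxLike.coeff 4 = CFNstxLike.axZero 4 ∧ CFNstxLike.coeff 5 = CFNstxLike.axZero 5 ∧
    CFNstxLike.coeff 6 = CFNstxLike.axZero 6 := by
  simp [coeff, axCoeffs, coeffs, axProj]

/-- `CFNstxLike.δ₀ = arcsin(7/20)` is coordinate 7 of `CFNstxLike.axZero`. -/
theorem δ₀N_eq_axZero : CFNstxLike.δ₀ = CFNstxLike.axZero 7 := by
  rw [axZero_seven]; rfl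

/-- **The parameters of THE instance lie in the parameter box.** -/
theorem boxMem_params : BoxMem params refBox := by
  obtain ⟨e0, e1, e2, e3, e4, e5, e6⟩ := coeffN_eq_axZero
  unfold params refBox
  rw [e0, e1, e2, e3, e4, e5, e6, δ₀N_eq_axZero]
  exact boxMem_cons (axZeroN_coord 0).1 (axZeroN_coord 0).2 <| boxMem_cons (axZeroN_coord 1).1 (axZeroN_coord 1).2 <|
    boxMem_cons (axZeroN_coord 2).1 (axZeroN_coord 2).2 <| boxMem_cons (axZeroN_coord 3).1 (axZeroN_coord 3).2 <|
    boxMem_cons (axZeroN_coord 4).1 (axZeroN_coord 4).2 <| boxMem_cons (axZeroN_coord 5).1 (axZeroN_coord 5).2 <|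
    boxMem_cons (axZeroN_coord 6).1 (axZeroN_coord 6).2 <| boxMem_cons (axZeroN_coord 7).1 (axZeroN_coord 7).2 boxMem_nil

/-- `U` of THE instance along the printed reference surface (6.154). -/
def refU (τ : ℝ) : ℝ := U (referenceSurface ε κ δ₀ τ).1 (referenceSurface ε κ δ₀ τ).2

/-- `refU` is the program run on the parameters of the instance. -/
theorem refU_eq_toFunP (τ : ℝ) : refU τ = refProg.toFunP params τ := by
  rw [refU, params, refProg_toFunP, coeffN_vec, referenceSurface_fst, referenceSurface_snd]
  rfl

/-! ## §3 The Taylor-model certificate: sixteen panels over `[0, 3217/1024] ⊃ [0, π]`, two points -/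

/-- Scale `S = 2⁶⁰` of the scaled-integer Taylor-model arithmetic. -/
def tmS : ℕ := 2 ^ 60
/-- `π̄ = 3217/1024 > π`, the right end of the covered parameter range. -/
def piBar : ℚ := 3217 / 1024
/-- Panel half-width `h = π̄/32` (sixteen panels). -/
def hw : ℚ := piBar / 32
/-- Centre of panel `j`: `(2j + 1) h`. -/
def ctr (j : ℕ) : ℚ := (2 * j + 1) * hw
/-- The Taylor model of `u ↦ refProg(ps; ctr j + u)`, `|u| ≤ h`, uniformly over the parameter box (degree 6,
composition order 14, `log` point order 40, `cis` point order 16 with 3 halvings), with its acceptance flag. -/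
def panelModel (j : ℕ) : IPoly × Bool := refProg.pmodelP tmS hw 6 14 1 1 40 16 3 (ctr j) refBox []
/-- The zero-width Taylor model at the rational point `c` (a point enclosure over the parameter box). -/
def pointModel (c : ℚ) : IPoly × Bool := refProg.pmodelP tmS 0 6 14 1 1 40 16 3 c refBox []
/-- Claimed lower bound of `U` on the reference curve: `−28/10⁵`. -/
def uLo : ℚ := -28 / 10 ^ 5
/-- Claimed upper bound of `U` on the reference curve: `8/10⁵`. -/
def uHi : ℚ := 8 / 10 ^ 5

/-- Per-panel Boolean obligation: model accepted and its range inside `[uLo, uHi]` (scaled by `S`). -/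
def panelOK (j : ℕ) : Bool :=
  (panelModel j).2 && decide (uLo * (tmS : ℚ) ≤ (tlowerI tmS hw (panelModel j).1 : ℚ))
    && decide ((tupperI tmS hw (panelModel j).1 : ℚ) ≤ uHi * (tmS : ℚ))

/-- **KERNEL CHECK**, panels 0–3. -/
theorem panels_ok₁ : (List.range' 0 4).all panelOK = true := by
  decide +kernel

/-- **KERNEL CHECK**, panels 4–7. -/
theorem panels_ok₂ : (List.range' 4 4).all panelOK = true := by
  decide +kernel

/-- **KERNEL CHECK**, panels 8–11. -/
theorem panels_ok₃ : (List.range' 8 4).all panelOK = true := by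
  decide +kernel

/-- **KERNEL CHECK**, panels 12–15. -/
theorem panels_ok₄ : (List.range' 12 4).all panelOK = true := by
  decide +kernel

/-- Point obligation at `τ = 201/256`: `U ≤ −23/10⁵` (scaled). -/
def pointIn : Bool :=
  (pointModel (201 / 256)).2 && decide ((tupperI tmS 0 (pointModel (201 / 256)).1 : ℚ) ≤ (-23 / 10 ^ 5 : ℚ) * (tmS : ℚ))
/-- Point obligation at `τ = 151/64`: `6/10⁵ ≤ U` (scaled). -/
def pointOut : Bool :=
  (pointModel (151 / 64)).2 && decide ((6 / 10 ^ 5 : ℚ) * (tmS : ℚ) ≤ (tlowerI tmS 0 (pointModel (151 / 64)).1 : ℚ))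

/-- **KERNEL CHECK** of the inside point. -/
theorem pointIn_ok : pointIn = true := by
  decide +kernel

/-- **KERNEL CHECK** of the outside point. -/
theorem pointOut_ok : pointOut = true := by
  decide +kernel

/-- Every one of the sixteen panels passes. -/
theorem panelOK_of_lt {j : ℕ} (hj : j < 16) : panelOK j = true := by
  have h1 := panels_ok₁; have h2 := panels_ok₂; have h3 := panels_ok₃; have h4 := panels_ok₄
  rw [List.all_eq_true] at h1 h2 h3 h4
  by_cases ha : j < 4
  · exact h1 j (List.mem_range'.mpr ⟨j, ha, by omega⟩)
  by_cases hb : j < 8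
  · exact h2 j (List.mem_range'.mpr ⟨j - 4, by omega, by omega⟩)
  by_cases hc : j < 12
  · exact h3 j (List.mem_range'.mpr ⟨j - 8, by omega, by omega⟩)
  · exact h4 j (List.mem_range'.mpr ⟨j - 12, by omega, by omega⟩)

/-- `0 < S`. -/
theorem tmS_pos : 0 < tmS := by norm_num [tmS]
/-- `0 ≤ h`. -/
theorem hw_nonneg : (0 : ℚ) ≤ hw := by norm_num [hw, piBar]

/-- **Soundness of one panel** (`TProg.tmem_pmodelP` + `bounds_of_tmem`): on panel `j`, for every parameter vector
of the box, `uLo ≤ refProg(ps; ctr j + u) ≤ uHi` for `|u| ≤ h`. -/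
theorem bounds_of_panelOK {j : ℕ} (h : panelOK j = true) {ps : List ℝ} (hB : BoxMem ps refBox) {u : ℝ}
    (hu : |u| ≤ hw) :
    ((uLo : ℚ) : ℝ) ≤ refProg.toFunP ps ((ctr j : ℚ) + u) ∧ refProg.toFunP ps ((ctr j : ℚ) + u) ≤ ((uHi : ℚ) : ℝ) := by
  simp only [panelOK, Bool.and_eq_true, decide_eq_true_eq] at h
  obtain ⟨⟨hok, hlo⟩, hhi⟩ := h
  have hf := TProg.tmem_pmodelP tmS_pos hw_nonneg (ctr j) refProg hB [] hok
  exact bounds_of_tmem tmS_pos hw_nonneg hf hlo hhi hu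

/-- Soundness of a zero-width point obligation, upper side. -/
theorem le_of_pointModel {c q : ℚ} (hok : (pointModel c).2 = true)
    (hhi : (tupperI tmS 0 (pointModel c).1 : ℚ) ≤ q * (tmS : ℚ)) {ps : List ℝ} (hB : BoxMem ps refBox) :
    refProg.toFunP ps (c : ℝ) ≤ ((q : ℚ) : ℝ) := by
  have hf := TProg.tmem_pmodelP tmS_pos le_rfl c refProg hB [] hok
  have hlo : ((tlowerI tmS 0 (pointModel c).1 : ℚ) / tmS : ℚ) * (tmS : ℚ) ≤ (tlowerI tmS 0 (pointModel c).1 : ℚ) := by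
    rw [div_mul_cancel₀ _ (by exact_mod_cast tmS_pos.ne')]
  have hb := bounds_of_tmem tmS_pos le_rfl hf hlo hhi (ρ := 0) (by simp)
  simpa using hb.2

/-- Soundness of a zero-width point obligation, lower side. -/
theorem ge_of_pointModel {c q : ℚ} (hok : (pointModel c).2 = true)
    (hlo : q * (tmS : ℚ) ≤ (tlowerI tmS 0 (pointModel c).1 : ℚ)) {ps : List ℝ} (hB : BoxMem ps refBox) :
    ((q : ℚ) : ℝ) ≤ refProg.toFunP ps (c : ℝ) := by
  have hf := TProg.tmem_pmodelP tmS_pos le_rfl c refProg hB [] hok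
  have hhi : (tupperI tmS 0 (pointModel c).1 : ℚ) ≤ ((tupperI tmS 0 (pointModel c).1 : ℚ) / tmS : ℚ) * (tmS : ℚ) := by
    rw [div_mul_cancel₀ _ (by exact_mod_cast tmS_pos.ne')]
  have hb := bounds_of_tmem tmS_pos le_rfl hf hlo hhi (ρ := 0) (by simp)
  simpa using hb.1

/-- **Covering:** every `τ ∈ [0, π̄]` lies in one of the sixteen panels. -/
theorem exists_panel {τ : ℝ} (h0 : 0 ≤ τ) (h1 : τ ≤ ((piBar : ℚ) : ℝ)) :
    ∃ j : ℕ, j < 16 ∧ |τ - ((ctr j : ℚ) : ℝ)| ≤ ((hw : ℚ) : ℝ) := by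
  have hwpos : (0 : ℝ) < ((hw : ℚ) : ℝ) := by norm_num [hw, piBar]
  have hpi : ((piBar : ℚ) : ℝ) = 32 * ((hw : ℚ) : ℝ) := by norm_num [hw, piBar]
  have hctr : ∀ j : ℕ, ((ctr j : ℚ) : ℝ) = (2 * (j : ℝ) + 1) * ((hw : ℚ) : ℝ) := fun j => by
    push_cast [ctr]; ring
  have hw2 : (0 : ℝ) < 2 * ((hw : ℚ) : ℝ) := by positivity
  have h3 : ((⌊τ / (2 * ((hw : ℚ) : ℝ))⌋₊ : ℕ) : ℝ) * (2 * ((hw : ℚ) : ℝ)) ≤ τ := by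
    rw [← le_div_iff₀ hw2]; exact Nat.floor_le (by positivity)
  have h4 : τ < (((⌊τ / (2 * ((hw : ℚ) : ℝ))⌋₊ : ℕ) : ℝ) + 1) * (2 * ((hw : ℚ) : ℝ)) := by
    rw [← div_lt_iff₀ hw2]; exact Nat.lt_floor_add_one _
  by_cases hk16 : ⌊τ / (2 * ((hw : ℚ) : ℝ))⌋₊ < 16
  · refine ⟨⌊τ / (2 * ((hw : ℚ) : ℝ))⌋₊, hk16, ?_⟩
    rw [hctr, abs_le]
    constructor <;> nlinarith
  · refine ⟨15, by norm_num, ?_⟩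
    push Not at hk16
    have h5 : (16 : ℝ) ≤ ((⌊τ / (2 * ((hw : ℚ) : ℝ))⌋₊ : ℕ) : ℝ) := by exact_mod_cast hk16
    have h6 : 16 * (2 * ((hw : ℚ) : ℝ)) ≤ τ := le_trans (by nlinarith) h3
    rw [hctr 15, abs_le]
    push_cast
    constructor <;> nlinarith

/-- **The bound on `[0, π̄]`** for THE instance: `uLo ≤ refProg(params; τ) ≤ uHi`. -/
theorem refProg_bounds_Icc {τ : ℝ} (h0 : 0 ≤ τ) (h1 : τ ≤ ((piBar : ℚ) : ℝ)) :
    ((uLo : ℚ) : ℝ) ≤ refProg.toFunP params τ ∧ refProg.toFunP params τ ≤ ((uHi : ℚ) : ℝ) := by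
  obtain ⟨j, hj, hu⟩ := exists_panel h0 h1
  have h := bounds_of_panelOK (panelOK_of_lt hj) boxMem_params hu
  have e : ((ctr j : ℚ) : ℝ) + (τ - ((ctr j : ℚ) : ℝ)) = τ := by ring
  rwa [e] at h

end Summit.Ventures.FusionMHD.Models.CFNstxLike
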